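import Literature.Probability.LatticeModels.LoopO1
import Literature.Probability.LatticeModels.IsingThermodynamics
import Literature.Probability.LatticeModels.ModifiedSimonInequality
import Literature.Probability.LatticeModels.GKSInequalities
import Summits.CriticalPhenomena.Ising3DConformalLimit.Theorems.FKParityRobustnessDefs
import Summits.CriticalPhenomena.Ising3DConformalLimit.Theorems.FKParityRobustnessDepletionBoundHTE
import Summits.CriticalPhenomena.Ising3DConformalLimit.Theorems.FKParityRobustnessIndependentStrandsJoinStubMassFirstMomentExchange
import HarnessLib

/-!
# Crux IndependentStrandsJoin (stmt-CriticalPhenomena-14625) — Paley–Zygmund glue for the hole mass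

Route `FKParityRobustness`, sub-problem `Ising3DConformalLimit`, line `union-shadow-exact`; registered aux stub
`stub_massConcentrationGlue` (lead `prover-line-stmt-CriticalPhenomena-14625-1`; reshape of stub 5 suggested by its
stub-worker): the line's stub 5 `stub_massConcentration : UnionAttach → BulkResponseFloor → MassPositive` is the
CONJUNCTION of a genuine `d = 3` input — the relative second moment of the hole mass,
`HoleMassSecondMoment : E[X(C⁺)²] ≤ C·(E X(C⁺))²` (cleared denominators, `l`-uniform) — and the routine implication proved
here:

`UnionAttach → BulkResponseFloor → HoleMassSecondMoment → MassPositive`  with `ε = c₀c₁/2`, `p = 1/(4·max C 1)`.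

Proof.  In the box, `W := Σ_{F₂,F₀} t^{|F₂|+|F₀|} = Z^{a₂a₃}·Z^∅`, `X(F₂,F₀) = Σ_{u ∈ bulk, a₂ ↝ u} δ_u ≥ 0`
(`δ_u ≥ 0`: GKS monotonicity of free correlations in the volume, `isingCorr_free_le_of_subset`), `s = ⟨σ_{a₀}σ_{a₁}⟩`.
FIRST MOMENT: by the landed exchange `stub_massFirstMomentExchange`, `Σ w·X = Σ_u δ_u·M(u)` with `M(u)` the one-point mass of
the hole; `UnionAttach` gives `M(u) ≥ c₀ Z^{a₂u}Z^{ua₃} = c₀ (Z^∅)² ⟨σ_{a₂}σ_u⟩⟨σ_uσ_{a₃}⟩` (high-temperature expansion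
`isingCorr_free_eq_hteSum_div`), and `BulkResponseFloor` gives `Σ_u ⟨σ_{a₂}σ_u⟩⟨σ_uσ_{a₃}⟩ δ_u ≥ c₁ ⟨σ_{a₂}σ_{a₃}⟩ s`, so
`Σ w X ≥ c₀c₁·W·s`.  PALEY–ZYGMUND (`weighted_paleyZygmund`, cleared denominators, with the degenerate cases): from
`Σ w X ≥ 2m W` (`m = εs`), `W·Σ w X² ≤ C (Σ w X)²` and `w, X ≥ 0` follows `W ≤ 4C·Σ_{X ≥ m} w` (Cauchy–Schwarz in the form
`Finset.sum_sq_le_sum_mul_sum_of_sq_le_mul`).  Theorem-only file; statements inlined (no `Theses` import).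

References: R. Paley, A. Zygmund (1932) / the second-moment method; M. Aizenman, H. Duminil-Copin, Ann. of Math. 194 (2021),
Lemma 4.4 (the template) [AizenmanDuminilCopinAnnals2021]; S. Friedli, Y. Velenik, *Statistical Mechanics of Lattice Systems*
(2017), §3.6–3.8 (GKS) [FriedliVelenik2017].
-/

noncomputable section

open Finset SimpleGraph
open Literature.Probability.LatticeModels
open Summit.CriticalPhenomena.Ising3DConformalLimit.Cruxes.ParityRobustMerging.PlaquetteXorSurgery
  (tetra tetra_injective tanh_criticalBeta_nonneg)

namespace Summit.CriticalPhenomena.Ising3DConformalLimit.Theorems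

open scoped Classical BigOperators

namespace StubMassConcentrationGlue

/-- **Weighted Paley–Zygmund with cleared denominators.**  For nonnegative weights `w` and values `X` on a finite
set, if the first moment is at least `2m` times the total weight and the total weight times the second moment is at
most `C` times the squared first moment (`C ≥ 1`), then the weight of `{X ≥ m}` is at least the total weight over `4C`. -/
theorem weighted_paleyZygmund {ι : Type*} (s : Finset ι) (w X : ι → ℝ) (hw : ∀ i ∈ s, 0 ≤ w i)
    (hX : ∀ i ∈ s, 0 ≤ X i) {m C : ℝ} (hC : 1 ≤ C) (hm : 0 ≤ m)
    (h1 : 2 * m * ∑ i ∈ s, w i ≤ ∑ i ∈ s, w i * X i)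
    (h2 : (∑ i ∈ s, w i) * ∑ i ∈ s, w i * X i ^ 2 ≤ C * (∑ i ∈ s, w i * X i) ^ 2) :
    ∑ i ∈ s, w i ≤ 4 * C * ∑ i ∈ s, (if m ≤ X i then w i else 0) := by
  set W := ∑ i ∈ s, w i with hW
  set M1 := ∑ i ∈ s, w i * X i with hM1
  set Q := ∑ i ∈ s, w i * X i ^ 2 with hQ
  set S := ∑ i ∈ s, (if m ≤ X i then w i else 0) with hS
  set A := ∑ i ∈ s, (if m ≤ X i then w i * X i else 0) with hA
  have hWnn : 0 ≤ W := Finset.sum_nonneg hw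
  have hSnn : 0 ≤ S := Finset.sum_nonneg fun i hi => by
    by_cases h : m ≤ X i
    · rw [if_pos h]; exact hw i hi
    · rw [if_neg h]
  have hM1nn : 0 ≤ M1 := Finset.sum_nonneg fun i hi => mul_nonneg (hw i hi) (hX i hi)
  -- `M1 ≤ A + m·W`
  have hsplit : M1 ≤ A + m * W := by
    rw [hM1, hA, hW, Finset.mul_sum, ← Finset.sum_add_distrib]
    refine Finset.sum_le_sum fun i hi => ?_
    by_cases h : m ≤ X i
    · rw [if_pos h]
      nlinarith [hw i hi, hX i hi]
    · rw [if_neg h, zero_add]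
      have : X i ≤ m := (not_le.mp h).le
      nlinarith [hw i hi]
  -- Cauchy–Schwarz: `A² ≤ Q·S`
  have hCS : A ^ 2 ≤ Q * S := by
    rw [hA, hQ, hS]
    refine Finset.sum_sq_le_sum_mul_sum_of_sq_le_mul s (fun i hi => ?_) (fun i hi => ?_) (fun i hi => ?_)
    · exact mul_nonneg (hw i hi) (sq_nonneg _)
    · by_cases h : m ≤ X i
      · rw [if_pos h]; exact hw i hi
      · rw [if_neg h]
    · by_cases h : m ≤ X i
      · rw [if_pos h, if_pos h]; nlinarith [hw i hi]
      · rw [if_neg h, if_neg h]; nlinarith [hw i hi, sq_nonneg (X i)]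
  -- `A ≥ M1/2`
  have hA2 : M1 ≤ 2 * A := by nlinarith [hsplit, h1]
  have hAnn : 0 ≤ A := by linarith
  -- main chain: `W·M1² ≤ 4·W·A² ≤ 4·W·Q·S ≤ 4·C·M1²·S`
  have hchain : W * M1 ^ 2 ≤ 4 * C * S * M1 ^ 2 := by
    have e1 : M1 ^ 2 ≤ 4 * A ^ 2 := by nlinarith [hA2, hM1nn, hAnn]
    calc W * M1 ^ 2 ≤ W * (4 * A ^ 2) := mul_le_mul_of_nonneg_left e1 hWnn
      _ ≤ W * (4 * (Q * S)) := by gcongr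
      _ = 4 * (W * Q) * S := by ring
      _ ≤ 4 * (C * M1 ^ 2) * S := by gcongr
      _ = 4 * C * S * M1 ^ 2 := by ring
  rcases hM1nn.eq_or_lt with hM0 | hMpos
  · -- degenerate: `M1 = 0` forces `m = 0` or `W = 0`
    have hmW : m * W ≤ 0 := by nlinarith [h1, hM0.symm]
    rcases hWnn.eq_or_lt with hW0 | hWpos
    · rw [← hW0]; positivity
    · have hm0 : m = 0 := le_antisymm (by nlinarith) hm
      have hSW : S = W := by
        rw [hS, hW]
        refine Finset.sum_congr rfl fun i hi => ?_
        rw [if_pos (hm0 ▸ hX i hi)]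
      rw [hSW]
      nlinarith
  · have hM2 : 0 < M1 ^ 2 := by positivity
    exact le_of_mul_le_mul_right hchain hM2

/-- The double-sum form of `weighted_paleyZygmund` (index set `s × r`). -/
theorem weighted_paleyZygmund₂ {ι κ : Type*} (s : Finset ι) (r : Finset κ) (w X : ι → κ → ℝ)
    (hw : ∀ i ∈ s, ∀ k ∈ r, 0 ≤ w i k) (hX : ∀ i ∈ s, ∀ k ∈ r, 0 ≤ X i k) {m C : ℝ} (hC : 1 ≤ C) (hm : 0 ≤ m)
    (h1 : 2 * m * ∑ i ∈ s, ∑ k ∈ r, w i k ≤ ∑ i ∈ s, ∑ k ∈ r, w i k * X i k)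
    (h2 : (∑ i ∈ s, ∑ k ∈ r, w i k) * ∑ i ∈ s, ∑ k ∈ r, w i k * X i k ^ 2 ≤
      C * (∑ i ∈ s, ∑ k ∈ r, w i k * X i k) ^ 2) :
    ∑ i ∈ s, ∑ k ∈ r, w i k ≤ 4 * C * ∑ i ∈ s, ∑ k ∈ r, (if m ≤ X i k then w i k else 0) := by
  have h := weighted_paleyZygmund (s ×ˢ r) (fun p => w p.1 p.2) (fun p => X p.1 p.2)
    (fun p hp => hw p.1 (Finset.mem_product.1 hp).1 p.2 (Finset.mem_product.1 hp).2)
    (fun p hp => hX p.1 (Finset.mem_product.1 hp).1 p.2 (Finset.mem_product.1 hp).2) hC hm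
    (by simpa only [Finset.sum_product] using h1)
    (by simpa only [Finset.sum_product] using h2)
  simpa only [Finset.sum_product] using h

end StubMassConcentrationGlue

open StubMassConcentrationGlue

/-- **Registered aux stub `stub_massConcentrationGlue`** (crux stmt-CriticalPhenomena-14625, line `union-shadow-exact`): the
Paley–Zygmund glue `UnionAttach → BulkResponseFloor → HoleMassSecondMoment → MassPositive` (all four inlined), with
`ε = c₀c₁/2`, `p = 1/(4·max C 1)`, `N₀ = max` of the three. -/
theorem stub_massConcentrationGlue :
    (∃ c₀ : ℝ, 0 < c₀ ∧ ∀ l : ℕ, 1 ≤ l → ∃ N₀ : ℕ, ∀ N : ℕ, N₀ ≤ N → ∀ a : Fin 4 → ↥(box 3 N), (∀ i, ((a i : Site 3)) = (l : ℤ) • (![![-1, -1, -1], ![1, 1, -1], ![1, -1, 1], ![-1, 1, 1]] : Fin 4 → Site 3) i) → (let G := ((zdGraph 3).comap (Subtype.val : ↥(box 3 N) → Site 3)); let t : ℝ := Real.tanh (criticalBeta 3); ∀ u : ↥(box 3 N), (∀ i, |(u : Site 3) i| ≤ 2 * (l : ℤ)) → u ∉ Finset.univ.image a → c₀ * loopO1PartitionFunction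 G t {a 2, u} * loopO1PartitionFunction G t {u, a 3} ≤ ∑ F₂ ∈ tJoins G Set.univ {a 2, a 3}, ∑ F₀ ∈ tJoins G Set.univ (∅ : Finset ↥(box 3 N)), if (SimpleGraph.fromEdgeSet ((↑F₂ : Set (Sym2 ↥(box 3 N))) ∪ ↑F₀)).Reachable (a 2) u then t ^ (F₂.card + F₀.card) else 0)) →
    (∃ c₁ : ℝ, 0 < c₁ ∧ ∀ l : ℕ, 1 ≤ l → ∃ N₀ : ℕ, ∀ N : ℕ, N₀ ≤ N → ∀ a : Fin 4 → ↥(box 3 N), (∀ i, ((a i : Site 3)) = (l : ℤ) • (![![-1, -1, -1], ![1, 1, -1], ![1, -1, 1], ![-1, 1, 1]] : Fin 4 → Site 3) i) → (let G := ((zdGraph 3).comap (Subtype.val : ↥(box 3 N) → Site 3)); c₁ * isingCorr G Finset.univ (criticalBeta 3) 0 .free {a 2, a 3} * isingCorr G Finset.univ (criticalBeta 3) 0 .free {a 0, a 1} ≤ ∑ u ∈ (Finset.univ : Finset ↥(box 3 N)).filter (fun u : ↥(box 3 N) => (∀ i, |(u : Site 3) i| ≤ 2 * (l : ℤ)) ∧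 u ∉ Finset.univ.image a), isingCorr G Finset.univ (criticalBeta 3) 0 .free {a 2, u} * isingCorr G Finset.univ (criticalBeta 3) 0 .free {u, a 3} * (isingCorr G Finset.univ (criticalBeta 3) 0 .free {a 0, a 1} - isingCorr G (Finset.univ.erase u) (criticalBeta 3) 0 .free {a 0, a 1}))) →
    (∃ C : ℝ, 0 < C ∧ ∀ l : ℕ, 1 ≤ l → ∃ N₀ : ℕ, ∀ N : ℕ, N₀ ≤ N → ∀ a : Fin 4 → ↥(box 3 N), (∀ i, ((a i : Site 3)) = (l : ℤ) • (![![-1, -1, -1], ![1, 1, -1], ![1, -1, 1], ![-1, 1, 1]] : Fin 4 → Site 3) i) → (let G := ((zdGraph 3).comap (Subtype.val : ↥(box 3 N) → Site 3)); let t : ℝ := Real.tanh (criticalBeta 3); loopO1PartitionFunction G t {a 2, a 3} * loopO1PartitionFunction G t ∅ * (∑ F₂ ∈ tJoins G Set.univ {a 2, a 3}, ∑ F₀ ∈ tJoins G Set.univ (∅ : Finset ↥(box 3 N)), t ^ (F₂.card + F₀.card) * (∑ u ∈ (Finset.univ : Finset ↥(box 3 N)).filter (fun u : ↥(box 3 N)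 => (∀ i, |(u : Site 3) i| ≤ 2 * (l : ℤ)) ∧ u ∉ Finset.univ.image a ∧ (SimpleGraph.fromEdgeSet ((↑F₂ : Set (Sym2 ↥(box 3 N))) ∪ ↑F₀)).Reachable (a 2) u), (isingCorr G Finset.univ (criticalBeta 3) 0 .free {a 0, a 1} - isingCorr G (Finset.univ.erase u) (criticalBeta 3) 0 .free {a 0, a 1})) ^ 2) ≤ C * (∑ F₂ ∈ tJoins G Set.univ {a 2, a 3}, ∑ F₀ ∈ tJoins G Set.univ (∅ : Finset ↥(box 3 N)), t ^ (F₂.card + F₀.card) * ∑ u ∈ (Finset.univ : Finset ↥(box 3 N)).filter (fun u : ↥(box 3 N) => (∀ i, |(u : Site 3) i| ≤ 2 * (l : ℤ)) ∧ u ∉ Finset.univ.image a ∧ (SimpleGraph.fromEdgeSet ((↑F₂ : Set (Sym2 ↥(box 3 N))) ∪ ↑F₀)).Reachable (a 2) u), (isingCorr G Finset.univ (criticalBeta 3) 0 .free {a 0, a 1} - isingCorr G (Finset.univ.erase u) (criticalBeta 3) 0 .free {a 0, a 1})) ^ 2)) →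
    (∃ ε : ℝ, 0 < ε ∧ ∃ p : ℝ, 0 < p ∧ ∀ l : ℕ, 1 ≤ l → ∃ N₀ : ℕ, ∀ N : ℕ, N₀ ≤ N → ∀ a : Fin 4 → ↥(box 3 N), (∀ i, ((a i : Site 3)) = (l : ℤ) • (![![-1, -1, -1], ![1, 1, -1], ![1, -1, 1], ![-1, 1, 1]] : Fin 4 → Site 3) i) → (let G := ((zdGraph 3).comap (Subtype.val : ↥(box 3 N) → Site 3)); let t : ℝ := Real.tanh (criticalBeta 3); p * loopO1PartitionFunction G t {a 2, a 3} * loopO1PartitionFunction G t ∅ ≤ ∑ F₂ ∈ tJoins G Set.univ {a 2, a 3}, ∑ F₀ ∈ tJoins G Set.univ (∅ : Finset ↥(box 3 N)), if ε * isingCorr G Finset.univ (criticalBeta 3) 0 .free {a 0, a 1} ≤ ∑ u ∈ (Finset.univ : Finset ↥(box 3 N)).filter (fun u : ↥(box 3 N) => (∀ i, |(u : Site 3) i| ≤ 2 * (l : ℤ)) ∧ u ∉ Finset.univ.image a ∧ (SimpleGraph.fromEdgeSet ((↑F₂ : Set (Sym2 ↥(box 3 N))) ∪ ↑F₀)).Reachable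 (a 2) u), (isingCorr G Finset.univ (criticalBeta 3) 0 .free {a 0, a 1} - isingCorr G (Finset.univ.erase u) (criticalBeta 3) 0 .free {a 0, a 1}) then t ^ (F₂.card + F₀.card) else 0)) := by
  rintro ⟨c₀, hc₀, hUA⟩ ⟨c₁, hc₁, hBR⟩ ⟨C, hC, hHM⟩
  refine ⟨c₀ * c₁ / 2, by positivity, 1 / (4 * max C 1), by positivity, fun l hl => ?_⟩
  obtain ⟨N₁, h1⟩ := hUA l hl
  obtain ⟨N₂, h2⟩ := hBR l hl
  obtain ⟨N₃, h3⟩ := hHM l hl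
  refine ⟨N₁ + N₂ + N₃, fun N hN a ha => ?_⟩
  have iUA := h1 N (by omega) a ha
  have iBR := h2 N (by omega) a ha
  have iHM := h3 N (by omega) a ha
  dsimp only at iUA iBR iHM ⊢
  -- notation
  set G : SimpleGraph ↥(box 3 N) := (zdGraph 3).comap (Subtype.val : ↥(box 3 N) → Site 3) with hG
  set t : ℝ := Real.tanh (criticalBeta 3) with ht
  have ht0 : 0 ≤ t := tanh_criticalBeta_nonneg
  have hβ0 : 0 ≤ criticalBeta 3 := criticalBeta_nonneg 3
  set s : ℝ := isingCorr G Finset.univ (criticalBeta 3) 0 .free {a 0, a 1} with hs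
  set B : Finset ↥(box 3 N) := (Finset.univ : Finset ↥(box 3 N)).filter
    (fun u : ↥(box 3 N) => (∀ i, |(u : Site 3) i| ≤ 2 * (l : ℤ)) ∧ u ∉ Finset.univ.image a) with hB
  set T23 := tJoins G Set.univ ({a 2, a 3} : Finset ↥(box 3 N)) with hT23
  set T0 := tJoins G Set.univ (∅ : Finset ↥(box 3 N)) with hT0
  set Z23 := loopO1PartitionFunction G t {a 2, a 3} with hZ23
  set Z0 := loopO1PartitionFunction G t ∅ with hZ0
  -- the deficit and the mass
  set δ : ↥(box 3 N) → ℝ := fun u => s - isingCorr G (Finset.univ.erase u) (criticalBeta 3) 0 .free {a 0, a 1}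
    with hδ
  set X : Finset (Sym2 ↥(box 3 N)) → Finset (Sym2 ↥(box 3 N)) → ℝ := fun F₂ F₀ =>
    ∑ u ∈ (Finset.univ : Finset ↥(box 3 N)).filter
        (fun u : ↥(box 3 N) => (∀ i, |(u : Site 3) i| ≤ 2 * (l : ℤ)) ∧ u ∉ Finset.univ.image a ∧
          (SimpleGraph.fromEdgeSet ((↑F₂ : Set (Sym2 ↥(box 3 N))) ∪ ↑F₀)).Reachable (a 2) u), δ u with hX
  have hinj : Function.Injective a := tetra_injective hl a (fun i => by rw [ha i]; rfl)
  have hZ0pos : 0 < Z0 := loopO1PartitionFunction_empty_pos G ht0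
  have hZ23nn : 0 ≤ Z23 := loopO1PartitionFunction_nonneg G ht0 _
  -- `δ_u ≥ 0` off the sources (GKS monotonicity in the volume)
  have hδnn : ∀ u : ↥(box 3 N), u ∉ Finset.univ.image a → 0 ≤ δ u := by
    intro u hu
    have hne : ∀ i, u ≠ a i := fun i h => hu (Finset.mem_image.2 ⟨i, Finset.mem_univ _, h.symm⟩)
    have hA : ({a 0, a 1} : Finset ↥(box 3 N)) ⊆ Finset.univ.erase u := by
      intro v hv
      rw [Finset.mem_insert, Finset.mem_singleton] at hv
      rw [Finset.mem_erase]
      rcases hv with rfl | rfl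
      · exact ⟨(hne 0).symm, Finset.mem_univ _⟩
      · exact ⟨(hne 1).symm, Finset.mem_univ _⟩
    exact sub_nonneg.2 (isingCorr_free_le_of_subset G hβ0 le_rfl hA (Finset.erase_subset _ _))
  have hXnn : ∀ F₂ F₀, 0 ≤ X F₂ F₀ := fun F₂ F₀ =>
    Finset.sum_nonneg fun u hu => hδnn u (Finset.mem_filter.1 hu).2.2.1
  -- normalise the instantiated hypotheses and the goal to the abstract names `δ`, `X`
  have hXu : ∀ F₂ F₀ : Finset (Sym2 ↥(box 3 N)),
      (∑ u ∈ (Finset.univ : Finset ↥(box 3 N)).filter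
        (fun u : ↥(box 3 N) => (∀ i, |(u : Site 3) i| ≤ 2 * (l : ℤ)) ∧ u ∉ Finset.univ.image a ∧
          (SimpleGraph.fromEdgeSet ((↑F₂ : Set (Sym2 ↥(box 3 N))) ∪ ↑F₀)).Reachable (a 2) u), δ u) = X F₂ F₀ :=
    fun _ _ => rfl
  simp only [hXu] at iHM ⊢
  -- total weight `W = Z23 · Z0`
  have hW : ∑ F₂ ∈ T23, ∑ F₀ ∈ T0, t ^ (F₂.card + F₀.card) = Z23 * Z0 := by
    rw [hZ23, hZ0, DepletionBound.loopO1PartitionFunction_eq_hteSum, DepletionBound.loopO1PartitionFunction_eq_hteSum,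
      ← DepletionBound.sum_tJoins_pow_eq_hteSum, ← DepletionBound.sum_tJoins_pow_eq_hteSum, Finset.sum_mul_sum]
    refine Finset.sum_congr rfl fun F₂ _ => Finset.sum_congr rfl fun F₀ _ => ?_
    rw [pow_add]
  -- high-temperature expansion of the two-point functions
  have hcorr : ∀ x y : ↥(box 3 N), isingCorr G Finset.univ (criticalBeta 3) 0 .free {x, y} =
      loopO1PartitionFunction G t {x, y} / Z0 := by
    intro x y
    rw [isingCorr_free_eq_hteSum_div G Finset.univ (criticalBeta 3) (Finset.subset_univ _),
      ← DepletionBound.loopO1PartitionFunction_eq_hteSum, ← DepletionBound.loopO1PartitionFunction_eq_hteSum]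
  -- the mass as a `B`-filtered sum
  have hXB : ∀ F₂ F₀, X F₂ F₀ = ∑ u ∈ B.filter (fun u : ↥(box 3 N) =>
      (SimpleGraph.fromEdgeSet ((↑F₂ : Set (Sym2 ↥(box 3 N))) ∪ ↑F₀)).Reachable (a 2) u), δ u := by
    intro F₂ F₀
    simp only [hX, hB, Finset.filter_filter, and_assoc]
  -- FIRST MOMENT: `Σ w X ≥ c₀ c₁ · W · s`
  have hM1 : 2 * (c₀ * c₁ / 2 * s) * ∑ F₂ ∈ T23, ∑ F₀ ∈ T0, t ^ (F₂.card + F₀.card) ≤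
      ∑ F₂ ∈ T23, ∑ F₀ ∈ T0, t ^ (F₂.card + F₀.card) * X F₂ F₀ := by
    have hex := stub_massFirstMomentExchange (↥(box 3 N)) G t B δ (a 2) (a 3)
    simp_rw [hXB]
    rw [hex, hW]
    -- one-point floor termwise (association exactly as in `UnionAttach`)
    have hsum1 : ∑ u ∈ B, δ u * (c₀ * loopO1PartitionFunction G t {a 2, u} *
        loopO1PartitionFunction G t {u, a 3}) ≤
        ∑ u ∈ B, δ u * ∑ F₂ ∈ T23, ∑ F₀ ∈ T0,
          (if (SimpleGraph.fromEdgeSet ((↑F₂ : Set (Sym2 ↥(box 3 N))) ∪ ↑F₀)).Reachable (a 2) u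
            then t ^ (F₂.card + F₀.card) else 0) := by
      refine Finset.sum_le_sum fun u hu => ?_
      obtain ⟨-, hbulk, hnot⟩ := Finset.mem_filter.1 hu
      exact mul_le_mul_of_nonneg_left (iUA u hbulk hnot) (hδnn u hnot)
    -- response floor in `Z`-form (clear the denominators of `iBR` by multiplying with `Z0²`)
    have hBR' : c₁ * Z23 * s * Z0 ≤ ∑ u ∈ B, δ u * (loopO1PartitionFunction G t {a 2, u} *
        loopO1PartitionFunction G t {u, a 3}) := by
      have h := mul_le_mul_of_nonneg_right iBR (sq_nonneg Z0)
      have hl : c₁ * isingCorr G Finset.univ (criticalBeta 3) 0 .free {a 2, a 3} * s * Z0 ^ 2 =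
          c₁ * Z23 * s * Z0 := by
        rw [hcorr (a 2) (a 3)]
        field_simp
        rw [hZ23]
        ring
      have hr : (∑ u ∈ B, isingCorr G Finset.univ (criticalBeta 3) 0 .free {a 2, u} *
          isingCorr G Finset.univ (criticalBeta 3) 0 .free {u, a 3} * δ u) * Z0 ^ 2 =
          ∑ u ∈ B, δ u * (loopO1PartitionFunction G t {a 2, u} * loopO1PartitionFunction G t {u, a 3}) := by
        rw [Finset.sum_mul]
        refine Finset.sum_congr rfl fun u _ => ?_
        rw [hcorr (a 2) u, hcorr u (a 3)]
        field_simp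
      calc c₁ * Z23 * s * Z0 = _ := hl.symm
        _ ≤ _ := h
        _ = _ := hr
    calc 2 * (c₀ * c₁ / 2 * s) * (Z23 * Z0) = c₀ * (c₁ * Z23 * s * Z0) := by ring
      _ ≤ c₀ * ∑ u ∈ B, δ u * (loopO1PartitionFunction G t {a 2, u} * loopO1PartitionFunction G t {u, a 3}) :=
          mul_le_mul_of_nonneg_left hBR' hc₀.le
      _ = ∑ u ∈ B, δ u * (c₀ * loopO1PartitionFunction G t {a 2, u} *
            loopO1PartitionFunction G t {u, a 3}) := by
          rw [Finset.mul_sum]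
          refine Finset.sum_congr rfl fun u _ => ?_
          ring
      _ ≤ _ := hsum1
  -- SECOND MOMENT hypothesis in PZ form
  set C' := max C 1 with hC'
  have hC'1 : 1 ≤ C' := le_max_right _ _
  have hCC' : C ≤ C' := le_max_left _ _
  have hM2 : (∑ F₂ ∈ T23, ∑ F₀ ∈ T0, t ^ (F₂.card + F₀.card)) *
      ∑ F₂ ∈ T23, ∑ F₀ ∈ T0, t ^ (F₂.card + F₀.card) * X F₂ F₀ ^ 2 ≤
      C' * (∑ F₂ ∈ T23, ∑ F₀ ∈ T0, t ^ (F₂.card + F₀.card) * X F₂ F₀) ^ 2 := by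
    rw [hW]
    exact iHM.trans (mul_le_mul_of_nonneg_right hCC' (sq_nonneg _))
  -- PALEY–ZYGMUND (forget the bodies of `X`, `δ`: only the inequalities above are used from here on)
  have hs0 : 0 ≤ s := GKSInequalities.gks_one_holds G hβ0 le_rfl (Or.inl rfl) (Finset.subset_univ _)
  clear_value X δ s
  have hm0 : 0 ≤ c₀ * c₁ / 2 * s := mul_nonneg (by positivity) hs0
  have hPZ := weighted_paleyZygmund₂ T23 T0 (fun F₂ F₀ => t ^ (F₂.card + F₀.card)) X
    (fun F₂ _ F₀ _ => pow_nonneg ht0 _) (fun F₂ _ F₀ _ => hXnn F₂ F₀) hC'1 hm0 hM1 hM2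
  -- conclude: `p · Z23 · Z0 ≤ Σ 1[ε s ≤ X] w`
  rw [hW] at hPZ
  have h4 : 0 < 4 * C' := by positivity
  have hgoal : 1 / (4 * C') * Z23 * Z0 ≤
      ∑ F₂ ∈ T23, ∑ F₀ ∈ T0, (if c₀ * c₁ / 2 * s ≤ X F₂ F₀ then t ^ (F₂.card + F₀.card) else 0) := by
    rw [show 1 / (4 * C') * Z23 * Z0 = (Z23 * Z0) / (4 * C') by ring, div_le_iff₀ h4]
    linarith [hPZ]
  exact hgoal

end Summit.CriticalPhenomena.Ising3DConformalLimit.Theorems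

end
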